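import Literature.NumberTheory.Weil1965.LocalQuadraticGaussTransformIntegrable
import HarnessLib

/-!
# The continuous fibre density of a diagonal quadratic form over a non-archimedean local field
(Weil 1965, Chap. III n° 36, Proposition 6 — finite places; file 3 of 3)

Topic `NumberTheory/Weil1965`; namespace `Literature.NumberTheory.Weil1965`.  KERNEL mathematics only (theorems; no
definition, no named fact, no `axiom`, no proof hole).  Sequel of `LocalQuadraticFibreDensityDecay.lean`.

`F` a non-archimedean local field, `μ` an additive Haar measure, `ψ` of conductor exponent `d`, `‖2‖ = q^{-v₂}`,
`f(x) = Σᵢ cᵢ xᵢ²` a DIAGONAL non-degenerate form on `X = F^ι` with `r = card ι ≥ 3`, `Φ ∈ 𝒮(X)` Schwartz–Bruhat,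
`G_Φ(β) = ∫_X Φ(x) ψ(β f(x)) dμ^⊗ι` its Gauss transform (written out as `∫ x, Φ x * psiSqPi ψ (β • c) x ∂μ^⊗ι`).
Weil [Weil1965, n° 34–36] shows that the image of `Φ dx` under `i_X = f` has a density `F_Φ` with respect to `db`,
that `F_Φ` and `F*_Φ = G_Φ` are Fourier transforms of each other, and (Prop. 6) that `F_Φ` is CONTINUOUS on all of `F`
as soon as `F*_Φ` is integrable — the previous file for `r ≥ 3`.  Here:

* §1 THE DENSITY `b ↦ 𝓕G_Φ(-b) = ∫ ψ(-bβ) G_Φ(β) dβ` (Tate's `fourierSB`) is CONTINUOUS on `F`, `0` included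
  (`continuous_fourierSB_integral_mul_psiSqPi_neg`), bounded by `‖G_Φ‖₁`, and satisfies the DISINTEGRATION IDENTITY
  `∫_F 𝓕G_Φ(-b) g(b) db = (q^{-d} μ(𝒪)²) ∫_X Φ(x) g(f(x)) dx` for every `g ∈ 𝒮(F)`
  (`integral_fourierSB_integral_mul_psiSqPi_neg_mul`; Tate's inversion ★ `fourierSB_fourierSB_eq` + Fubini twice; the
  constant is `1` for the self-dual `μ`);
* §2 consequences: the mass of a fibre neighbourhood `∫_{b₀+𝔭^k} 𝓕G_Φ(-b) db = (q^{-d}μ(𝒪)²) ∫ Φ 1_{b₀+𝔭^k}(f)`, the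
  density as the LIMIT OF AVERAGES `(q^{-d}μ(𝒪)²) μ(𝔭^k)⁻¹ ∫ Φ 1_{b₀+𝔭^k}(f) → 𝓕G_Φ(-b₀)` at EVERY `b₀`
  (`tendsto_average_fibre`), and the bundled Prop. 6 `exists_continuous_fibreDensity`.

NOT here: homogeneity of `F_Φ` under `x ↦ t x` / isometries of `f` (change of variables on `F^ι`), the explicit
unramified value, positivity and total mass `∫ F_Φ = ∫ Φ` — sequel files.

## References

* [Weil1965] A. Weil, *Sur la formule de Siegel dans la théorie des groupes classiques*, Acta Math. 113 (1965) 1–87: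
  Chap. I n° 2 Prop. 2 (p. 8); Chap. III n° 34–36, Prop. 6 (p. 54).
* [Tate1950] J. Tate, *Fourier analysis in number fields and Hecke's zeta-functions* (1950), §2.2 Thm 2.2.2 (local
  Fourier inversion; tree file `TateSelfDualHaar`).
* [WeilBNT1967] A. Weil, *Basic Number Theory* (1967), Chap. VII §2 Prop. 2 (standard functions on `F^ι`).
* [BushnellHenniart2006] C. J. Bushnell, G. Henniart, *The local Langlands conjecture for GL(2)* (2006), §1.7.
-/

set_option autoImplicit false

noncomputable section

open MeasureTheory ValuativeRel Filter Topology Set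
open scoped NNReal ENNReal Pointwise
open Literature.NumberTheory.GaloisRepresentations.IsNonarchimedeanLocalField
open Literature.NumberTheory.Automorphic
open Literature.NumberTheory.Weil1964

namespace Literature.NumberTheory.Weil1965

variable {F : Type*} [Field F] [ValuativeRel F] [TopologicalSpace F] [IsNonarchimedeanLocalField F]

section FibreDensity

variable {ι : Type*} [Fintype ι] [MeasurableSpace F] [BorelSpace F] (μ : Measure F) [μ.IsAddHaarMeasure]
  {ψ : AddChar F Circle}

omit [BorelSpace F] in
/-- a Haar measure on `F` is `σ`-finite (instance helper). [folklore] -/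
private theorem sigmaFinite_haar₃ : SigmaFinite μ := by
  haveI : T2Space F :=
    (Literature.NumberTheory.GaloisRepresentations.IsNonarchimedeanLocalField.isLocalField F).toT2Space
  haveI : LocallyCompactSpace F :=
    (Literature.NumberTheory.GaloisRepresentations.IsNonarchimedeanLocalField.isLocalField F).toLocallyCompactSpace
  haveI : SecondCountableTopology F := secondCountableTopology_localField F
  infer_instance

/-! ### The fibre density `b ↦ 𝓕G_Φ(-b)` -/

omit [Field F] [ValuativeRel F] [IsNonarchimedeanLocalField F] [BorelSpace F] [μ.IsAddHaarMeasure] in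
/-- a Schwartz–Bruhat function on `F` is integrable. [cite: Tate1950, §2.2] -/
private theorem integrable_of_mem_schwartzBruhat_one [BorelSpace F] [IsFiniteMeasureOnCompacts μ] {g : F → ℂ}
    (hg : g ∈ SchwartzBruhat F) : Integrable g μ :=
  hg.1.continuous.integrable_of_hasCompactSupport hg.2

/-- **THE FIBRE DENSITY IS CONTINUOUS ON ALL OF `F`** [Weil1965, Chap. III n° 36 Prop. 6: "`F_Φ` … sont continues"]:
for `r = card ι ≥ 3` the function `b ↦ 𝓕G_Φ(-b) = ∫ ψ(-b β) G_Φ(β) dβ` is continuous — at `b = 0` included — by dominated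
convergence against the integrable `|G_Φ|`. [cite: Weil1965, Chap. III n° 36 Prop. 6, p. 54] -/
theorem continuous_fourierSB_integral_mul_psiSqPi_neg {d : ℤ} (hd : ψ.HasConductorExp d) {v₂ : ℤ}
    (h2 : normAbs F (2 : F) = (residueFieldCard F : ℝ≥0)⁻¹ ^ v₂) {c : ι → F} (hc : ∀ i, c i ≠ 0)
    {Φ : (ι → F) → ℂ} (hΦ : Φ ∈ SchwartzBruhat (ι → F)) (hr : 3 ≤ Fintype.card ι) :
    Continuous fun b : F =>
      fourierSB ψ μ (fun β => ∫ x, Φ x * psiSqPi ψ (fun i => β * c i) x ∂(Measure.pi fun _ : ι => μ)) (-b) := by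
  haveI : SecondCountableTopology F := secondCountableTopology_localField F
  set G : F → ℂ := fun β => ∫ x, Φ x * psiSqPi ψ (fun i => β * c i) x ∂(Measure.pi fun _ : ι => μ) with hGdef
  have hψ : Continuous ψ := continuous_of_hasConductorExp hd
  have hGi : Integrable G μ := integrable_integral_mul_psiSqPi μ hd h2 hc hΦ hr
  have hGc : Continuous G := continuous_integral_mul_psiSqPi μ hψ c hΦ
  simp only [fourierSB_apply]
  refine continuous_of_dominated (bound := fun β => ‖G β‖) (fun b => ?_) (fun b => Eventually.of_forall fun β => ?_)
    hGi.norm (Eventually.of_forall fun β => ?_)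
  · exact ((continuous_subtype_val.comp (hψ.comp (continuous_id.mul continuous_const))).mul hGc).aestronglyMeasurable
  · rw [norm_mul, Circle.norm_coe, one_mul]
  · exact (continuous_subtype_val.comp (hψ.comp (continuous_const.mul continuous_neg))).mul continuous_const

omit [ValuativeRel F] [TopologicalSpace F] [IsNonarchimedeanLocalField F] [BorelSpace F] [μ.IsAddHaarMeasure] in
/-- the fibre density is **bounded** by `‖G_Φ‖₁`. [cite: Weil1965, Chap. III n° 36 Prop. 6, p. 54] -/
theorem norm_fourierSB_integral_mul_psiSqPi_neg_le (c : ι → F) (Φ : (ι → F) → ℂ) (b : F) :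
    ‖fourierSB ψ μ (fun β => ∫ x, Φ x * psiSqPi ψ (fun i => β * c i) x ∂(Measure.pi fun _ : ι => μ)) (-b)‖ ≤
      ∫ β, ‖∫ x, Φ x * psiSqPi ψ (fun i => β * c i) x ∂(Measure.pi fun _ : ι => μ)‖ ∂μ := by
  rw [fourierSB_apply]
  refine (norm_integral_le_integral_norm _).trans (le_of_eq (integral_congr_ae (Eventually.of_forall fun β => ?_)))
  simp only [norm_mul, Circle.norm_coe, one_mul]

/-- **DISINTEGRATION OF `Φ dμ^⊗ι` ALONG THE FIBRES OF `f`** [Weil1965, Chap. III n° 34–36: `F_Φ` is the density of the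
image of `Φ dx` under `i_X`, `F_Φ` and `F*_Φ = G_Φ` are Fourier transforms of each other]: for every Schwartz–Bruhat `g`
on `F`,
  `∫_F 𝓕G_Φ(-b) · g(b) dμ(b) = (q^{-d} μ(𝒪)²) · ∫_{F^ι} Φ(x) g(f(x)) dμ^⊗ι(x)`,   `f(x) = Σ cᵢ xᵢ²`,
i.e. `(q^{-d} μ(𝒪)²)⁻¹ · 𝓕G_Φ(-·)` is a continuous density of `f_*(Φ μ^⊗ι)` with respect to `μ` (the constant is `1` for
the self-dual `μ`, ★ `isSelfDualMeasure_iff`).  Proof: Tate's inversion `(ĝ)̂ = q^{-d} μ(𝒪)² g(-·)` for `g`, and two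
applications of Fubini. [cite: Weil1965, Chap. III n° 36 Prop. 6, p. 54] -/
theorem integral_fourierSB_integral_mul_psiSqPi_neg_mul {d : ℤ} (hd : ψ.HasConductorExp d) {v₂ : ℤ}
    (h2 : normAbs F (2 : F) = (residueFieldCard F : ℝ≥0)⁻¹ ^ v₂) {c : ι → F} (hc : ∀ i, c i ≠ 0)
    {Φ : (ι → F) → ℂ} (hΦ : Φ ∈ SchwartzBruhat (ι → F)) (hr : 3 ≤ Fintype.card ι) {g : F → ℂ}
    (hg : g ∈ SchwartzBruhat F) :
    ∫ b, fourierSB ψ μ (fun β => ∫ x, Φ x * psiSqPi ψ (fun i => β * c i) x ∂(Measure.pi fun _ : ι => μ)) (-b) * g b ∂μ =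
      (selfDualConst μ d : ℂ) * ∫ x, Φ x * g (∑ i, c i * x i ^ 2) ∂(Measure.pi fun _ : ι => μ) := by
  haveI : SecondCountableTopology F := secondCountableTopology_localField F
  haveI := sigmaFinite_haar₃ μ
  set G : F → ℂ := fun β => ∫ x, Φ x * psiSqPi ψ (fun i => β * c i) x ∂(Measure.pi fun _ : ι => μ) with hGdef
  have hψ : Continuous ψ := continuous_of_hasConductorExp hd
  have hψ' : ψ.IsContinuousNontrivial := isContinuousNontrivial_of_hasConductorExp hd
  have hGi : Integrable G μ := integrable_integral_mul_psiSqPi μ hd h2 hc hΦ hr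
  have hGc : Continuous G := continuous_integral_mul_psiSqPi μ hψ c hΦ
  have hgi : Integrable g μ := integrable_of_mem_schwartzBruhat_one μ hg
  have hgc : Continuous g := hg.1.continuous
  have hĝ : fourierSB ψ μ g ∈ SchwartzBruhat F := fourierSB_mem_schwartzBruhat μ hψ' hg
  have hĝi : Integrable (fourierSB ψ μ g) μ := integrable_of_mem_schwartzBruhat_one μ hĝ
  have hĝc : Continuous (fourierSB ψ μ g) := hĝ.1.continuous
  have hΦi : Integrable Φ (Measure.pi fun _ : ι => μ) := integrable_of_mem_schwartzBruhat_pi μ hψ hΦ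
  have hψc2 : Continuous fun p : F × F => ((ψ (p.1 * p.2) : Circle) : ℂ) :=
    continuous_subtype_val.comp (hψ.comp (continuous_fst.mul continuous_snd))
  -- STEP A: `∫_b 𝓕G(-b) g(b) = ∫_β G(β) ĝ(-β)`
  have stepA : ∫ b, fourierSB ψ μ G (-b) * g b ∂μ = ∫ β, G β * fourierSB ψ μ g (-β) ∂μ := by
    have e1 : (fun b => fourierSB ψ μ G (-b) * g b) = fun b => ∫ β, ((ψ (β * -b) : Circle) : ℂ) * G β * g b ∂μ := by
      funext b
      rw [fourierSB_apply, ← integral_mul_const]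
    have e2 : (fun β => G β * fourierSB ψ μ g (-β)) = fun β => ∫ b, ((ψ (β * -b) : Circle) : ℂ) * G β * g b ∂μ := by
      funext β
      rw [fourierSB_apply, ← integral_const_mul]
      refine integral_congr_ae (Eventually.of_forall fun b => ?_)
      show G β * (((ψ (b * -β) : Circle) : ℂ) * g b) = ((ψ (β * -b) : Circle) : ℂ) * G β * g b
      rw [show b * -β = β * -b by ring]
      ring
    rw [e1, e2]
    refine integral_integral_swap ?_
    -- integrability on `F × F`: dominated by `‖G β‖ ‖g b‖`
    have hprod : Integrable (fun z : F × F => G z.2 * g z.1) (μ.prod μ) := by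
      simpa [mul_comm] using hgi.mul_prod hGi
    refine hprod.mono ?_ (Eventually.of_forall fun z => ?_)
    · exact (((hψc2.comp (continuous_snd.prodMk continuous_fst.neg)).mul (hGc.comp continuous_snd)).mul
        (hgc.comp continuous_fst)).aestronglyMeasurable
    · obtain ⟨b, β⟩ := z
      simp only [Function.uncurry_apply_pair, norm_mul, Circle.norm_coe, one_mul, le_refl]
  -- STEP B: `sdc · ∫ Φ g(f) = ∫_β ĝ(β) G(-β)`
  have stepB : (selfDualConst μ d : ℂ) * ∫ x, Φ x * g (∑ i, c i * x i ^ 2) ∂(Measure.pi fun _ : ι => μ) =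
      ∫ β, fourierSB ψ μ g β * G (-β) ∂μ := by
    -- Tate inversion: `sdc · g(t) = ∫ ψ(β · (-t)) ĝ(β) dβ`
    have hinv : ∀ t : F, (selfDualConst μ d : ℂ) * g t = ∫ β, ((ψ (β * -t) : Circle) : ℂ) * fourierSB ψ μ g β ∂μ := by
      intro t
      have h := congr_fun (fourierSB_fourierSB_eq μ hψ hd hg) (-t)
      rw [neg_neg] at h
      rw [← h, fourierSB_apply]
    have e1 : (fun x => Φ x * g (∑ i, c i * x i ^ 2)) = fun x => (selfDualConst μ d : ℂ)⁻¹ *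
        ∫ β, Φ x * (((ψ (β * -(∑ i, c i * x i ^ 2)) : Circle) : ℂ) * fourierSB ψ μ g β) ∂μ := by
      funext x
      have hsdc : (selfDualConst μ d : ℂ) ≠ 0 := by exact_mod_cast (selfDualConst_pos μ).ne'
      have h1 := hinv (∑ i, c i * x i ^ 2)
      rw [integral_const_mul, ← h1, mul_left_comm (Φ x), inv_mul_cancel_left₀ hsdc]
    rw [e1, integral_const_mul, ← mul_assoc, mul_inv_cancel₀ (by exact_mod_cast (selfDualConst_pos μ).ne'), one_mul]
    have e2 : (fun β => fourierSB ψ μ g β * G (-β)) =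
        fun β => ∫ x, Φ x * (((ψ (β * -(∑ i, c i * x i ^ 2)) : Circle) : ℂ) * fourierSB ψ μ g β) ∂(Measure.pi fun _ : ι => μ) := by
      funext β
      rw [hGdef]
      simp only
      rw [← integral_const_mul]
      refine integral_congr_ae (Eventually.of_forall fun x => ?_)
      dsimp only
      rw [psiSqPi_smul_apply, show -β * ∑ i, c i * x i ^ 2 = β * -∑ i, c i * x i ^ 2 by ring]
      ring
    rw [e2]
    refine integral_integral_swap ?_
    have hprod : Integrable (fun z : (ι → F) × F => Φ z.1 * fourierSB ψ μ g z.2) ((Measure.pi fun _ : ι => μ).prod μ) :=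
      hΦi.mul_prod hĝi
    refine hprod.mono ?_ (Eventually.of_forall fun z => ?_)
    · have hq : Continuous fun x : ι → F => ∑ i, c i * x i ^ 2 :=
        continuous_finsetSum _ fun i _ => continuous_const.mul ((continuous_apply i).pow 2)
      exact ((hΦ.1.continuous.comp continuous_fst).mul
        ((hψc2.comp (continuous_snd.prodMk (hq.comp continuous_fst).neg)).mul (hĝc.comp continuous_snd))).aestronglyMeasurable
    · obtain ⟨x, β⟩ := z
      simp only [Function.uncurry_apply_pair, norm_mul, Circle.norm_coe, one_mul, le_refl]
  -- STEP C: `β ↦ -β`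
  have stepC : ∫ β, fourierSB ψ μ g β * G (-β) ∂μ = ∫ β, G β * fourierSB ψ μ g (-β) ∂μ := by
    have h := LocalFieldHaar.integral_comp_mul_left_of_normAbs_eq_one μ (fun β => G β * fourierSB ψ μ g (-β))
      (u := -1) (by rw [normAbs_neg, map_one])
    rw [← h]
    refine integral_congr_ae (Eventually.of_forall fun β => ?_)
    show fourierSB ψ μ g β * G (-β) = G (-1 * β) * fourierSB ψ μ g (-(-1 * β))
    rw [neg_one_mul, neg_neg, mul_comm]
  rw [stepA, stepB, stepC]

/-! ### Consequences: averages over shrinking balls, and the bundled statement -/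

omit [MeasurableSpace F] [BorelSpace F] in
/-- the indicator of a coset `a + 𝔭^n` (times a constant) is a Schwartz–Bruhat function. [cite: Tate1950, §2.2] -/
theorem indicator_vadd_primePowBall_mem_schwartzBruhat (n : ℤ) (a : F) (z : ℂ) :
    (a +ᵥ primePowBall F n).indicator (fun _ => z) ∈ SchwartzBruhat F := by
  have ho : IsOpen (a +ᵥ primePowBall F n) := (isOpen_primePowBall n).vadd _
  have hcl : IsClosed (a +ᵥ primePowBall F n) := (isClosed_primePowBall n).vadd _
  rw [mem_schwartzBruhat_iff]
  refine ⟨?_, HasCompactSupport.intro' ((isCompact_primePowBall n).vadd a) hcl fun x hx => Set.indicator_of_notMem hx _⟩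
  rw [IsLocallyConstant.iff_exists_open]
  intro x
  by_cases hx : x ∈ a +ᵥ primePowBall F n
  · exact ⟨_, ho, hx, fun y hy => by rw [Set.indicator_of_mem hy, Set.indicator_of_mem hx]⟩
  · exact ⟨_, hcl.isOpen_compl, hx, fun y hy => by
      rw [Set.indicator_of_notMem (show y ∉ _ from hy), Set.indicator_of_notMem hx]⟩

/-- **MASS OF A FIBRE NEIGHBOURHOOD**: `∫_{b₀ + 𝔭^k} 𝓕G_Φ(-b) db = (q^{-d} μ(𝒪)²) · ∫ Φ(x) 1_{b₀ + 𝔭^k}(f(x)) dμ^⊗ι(x)` — the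
disintegration tested against the indicator of a ball around `b₀`. [cite: Weil1965, Chap. III n° 36 Prop. 6, p. 54] -/
theorem setIntegral_vadd_primePowBall_fourierSB_integral_mul_psiSqPi_neg {d : ℤ} (hd : ψ.HasConductorExp d) {v₂ : ℤ}
    (h2 : normAbs F (2 : F) = (residueFieldCard F : ℝ≥0)⁻¹ ^ v₂) {c : ι → F} (hc : ∀ i, c i ≠ 0)
    {Φ : (ι → F) → ℂ} (hΦ : Φ ∈ SchwartzBruhat (ι → F)) (hr : 3 ≤ Fintype.card ι) (b₀ : F) (k : ℤ) :
    ∫ b in b₀ +ᵥ primePowBall F k,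
        fourierSB ψ μ (fun β => ∫ x, Φ x * psiSqPi ψ (fun i => β * c i) x ∂(Measure.pi fun _ : ι => μ)) (-b) ∂μ =
      (selfDualConst μ d : ℂ) * ∫ x, Φ x * (b₀ +ᵥ primePowBall F k).indicator (fun _ => (1 : ℂ)) (∑ i, c i * x i ^ 2)
        ∂(Measure.pi fun _ : ι => μ) := by
  rw [← integral_fourierSB_integral_mul_psiSqPi_neg_mul μ hd h2 hc hΦ hr
    (indicator_vadd_primePowBall_mem_schwartzBruhat k b₀ 1), ← integral_indicator (measurableSet_vadd_primePowBall k b₀)]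
  refine integral_congr_ae (Eventually.of_forall fun b => ?_)
  dsimp only
  by_cases hb : b ∈ b₀ +ᵥ primePowBall F k
  · rw [Set.indicator_of_mem hb, Set.indicator_of_mem hb, mul_one]
  · rw [Set.indicator_of_notMem hb, Set.indicator_of_notMem hb, mul_zero]

omit [BorelSpace F] [μ.IsAddHaarMeasure] in
/-- averages of a continuous function over the shrinking balls `b₀ + 𝔭^k` converge to its value (the balls form a
neighbourhood basis). [folklore] -/
private theorem tendsto_average_vadd_primePowBall [BorelSpace F] [μ.IsAddHaarMeasure] {D : F → ℂ} (hD : Continuous D)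
    (b₀ : F) :
    Tendsto (fun k : ℕ => (μ.real (primePowBall F k) : ℂ)⁻¹ * ∫ b in b₀ +ᵥ primePowBall F k, D b ∂μ) atTop
      (𝓝 (D b₀)) := by
  haveI : T2Space F :=
    (Literature.NumberTheory.GaloisRepresentations.IsNonarchimedeanLocalField.isLocalField F).toT2Space
  refine Metric.tendsto_atTop.2 fun ε hε => ?_
  have hU : {b | dist (D b) (D b₀) < ε / 2} ∈ 𝓝 b₀ :=
    (Metric.isOpen_ball.preimage hD).mem_nhds (by simpa using half_pos hε)
  have hU0 : (fun t => b₀ + t) ⁻¹' {b | dist (D b) (D b₀) < ε / 2} ∈ 𝓝 (0 : F) :=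
    (continuous_const.add continuous_id).continuousAt.preimage_mem_nhds (by simpa using hU)
  obtain ⟨K, hK⟩ := exists_primePowBall_subset_of_mem_nhds_zero hU0
  refine ⟨K, fun k hk => ?_⟩
  have hsub : ∀ b ∈ b₀ +ᵥ primePowBall F k, ‖D b - D b₀‖ ≤ ε / 2 := by
    intro b hb
    obtain ⟨t, ht, rfl⟩ := Set.mem_vadd_set.1 hb
    have ht' : t ∈ primePowBall F (K : ℤ) := primePowBall_antitone (by exact_mod_cast hk) ht
    have := hK ht'
    rw [Set.mem_preimage, Set.mem_setOf_eq, dist_eq_norm] at this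
    exact this.le
  have hμpos : 0 < μ.real (primePowBall F k) := LocalFieldHaar.measureReal_primePowBall_pos μ k
  have hμeq : μ.real (b₀ +ᵥ primePowBall F k) = μ.real (primePowBall F k) := by
    rw [measureReal_def, measureReal_def, measure_vadd]
  have hfin : μ (b₀ +ᵥ primePowBall F k) < ∞ := (isCompact_vadd_primePowBall k b₀).measure_lt_top
  -- `avg - D b₀ = μ(B)⁻¹ ∫_B (D - D b₀)`
  have hDint : IntegrableOn D (b₀ +ᵥ primePowBall F k) μ :=
    hD.continuousOn.integrableOn_compact (isCompact_vadd_primePowBall k b₀)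
  have e : (μ.real (primePowBall F k) : ℂ)⁻¹ * ∫ b in b₀ +ᵥ primePowBall F k, D b ∂μ - D b₀ =
      (μ.real (primePowBall F k) : ℂ)⁻¹ * ∫ b in b₀ +ᵥ primePowBall F k, (D b - D b₀) ∂μ := by
    rw [integral_sub hDint (integrableOn_const hfin.ne), setIntegral_const, hμeq, Complex.real_smul, mul_sub,
      ← mul_assoc, inv_mul_cancel₀ (by exact_mod_cast hμpos.ne'), one_mul]
  rw [dist_eq_norm, e, norm_mul, norm_inv, Complex.norm_real, Real.norm_of_nonneg hμpos.le]
  calc (μ.real (primePowBall F k))⁻¹ * ‖∫ b in b₀ +ᵥ primePowBall F k, (D b - D b₀) ∂μ‖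
      ≤ (μ.real (primePowBall F k))⁻¹ * (ε / 2 * μ.real (b₀ +ᵥ primePowBall F k)) :=
        mul_le_mul_of_nonneg_left (norm_setIntegral_le_of_norm_le_const hfin hsub) (inv_nonneg.2 hμpos.le)
    _ = ε / 2 := by rw [hμeq, mul_comm, mul_assoc, mul_inv_cancel₀ hμpos.ne', mul_one]
    _ < ε := half_lt_self hε

/-- **THE FIBRE DENSITY AS A LIMIT OF AVERAGES** (the elementary definition of the density of `f_*(Φ dx)` at `b₀`):
`(q^{-d} μ(𝒪)²) · μ(𝔭^k)⁻¹ · ∫ Φ(x) 1_{b₀ + 𝔭^k}(f(x)) dμ^⊗ι(x) ⟶ 𝓕G_Φ(-b₀)` as `k → ∞`, for EVERY `b₀ ∈ F` (`b₀ = 0`, the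
singular fibre, included). [cite: Weil1965, Chap. III n° 36 Prop. 6, p. 54] -/
theorem tendsto_average_fibre {d : ℤ} (hd : ψ.HasConductorExp d) {v₂ : ℤ}
    (h2 : normAbs F (2 : F) = (residueFieldCard F : ℝ≥0)⁻¹ ^ v₂) {c : ι → F} (hc : ∀ i, c i ≠ 0)
    {Φ : (ι → F) → ℂ} (hΦ : Φ ∈ SchwartzBruhat (ι → F)) (hr : 3 ≤ Fintype.card ι) (b₀ : F) :
    Tendsto (fun k : ℕ => (selfDualConst μ d : ℂ) * (μ.real (primePowBall F k) : ℂ)⁻¹ *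
        ∫ x, Φ x * (b₀ +ᵥ primePowBall F k).indicator (fun _ => (1 : ℂ)) (∑ i, c i * x i ^ 2)
          ∂(Measure.pi fun _ : ι => μ)) atTop
      (𝓝 (fourierSB ψ μ (fun β => ∫ x, Φ x * psiSqPi ψ (fun i => β * c i) x ∂(Measure.pi fun _ : ι => μ)) (-b₀))) := by
  have h := tendsto_average_vadd_primePowBall μ (continuous_fourierSB_integral_mul_psiSqPi_neg μ hd h2 hc hΦ hr) b₀
  refine h.congr fun k => ?_
  rw [setIntegral_vadd_primePowBall_fourierSB_integral_mul_psiSqPi_neg μ hd h2 hc hΦ hr b₀ k]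
  ring

/-- **WEIL'S PROPOSITION 6 AT A FINITE PLACE, BUNDLED** [Weil1965, Chap. III n° 36 Prop. 6]: for a diagonal
non-degenerate form `f = Σ cᵢ xᵢ²` in `r ≥ 3` variables over a `p`-field and a Schwartz–Bruhat `Φ`, the image of `Φ dμ^⊗ι`
under `f` has a CONTINUOUS, BOUNDED density `F_Φ` on ALL of `F` with respect to `μ`:
`∫ F_Φ(b) g(b) dμ(b) = ∫ Φ(x) g(f(x)) dμ^⊗ι(x)` for every Schwartz–Bruhat `g` — namely
`F_Φ = (q^{-d} μ(𝒪)²)⁻¹ · 𝓕G_Φ(-·)`. [cite: Weil1965, Chap. III n° 36 Prop. 6, p. 54] -/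
theorem exists_continuous_fibreDensity {d : ℤ} (hd : ψ.HasConductorExp d) {v₂ : ℤ}
    (h2 : normAbs F (2 : F) = (residueFieldCard F : ℝ≥0)⁻¹ ^ v₂) {c : ι → F} (hc : ∀ i, c i ≠ 0)
    {Φ : (ι → F) → ℂ} (hΦ : Φ ∈ SchwartzBruhat (ι → F)) (hr : 3 ≤ Fintype.card ι) :
    ∃ D : F → ℂ, Continuous D ∧ (∃ M : ℝ, ∀ b, ‖D b‖ ≤ M) ∧
      ∀ g ∈ SchwartzBruhat F, ∫ b, D b * g b ∂μ = ∫ x, Φ x * g (∑ i, c i * x i ^ 2) ∂(Measure.pi fun _ : ι => μ) := by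
  set G : F → ℂ := fun β => ∫ x, Φ x * psiSqPi ψ (fun i => β * c i) x ∂(Measure.pi fun _ : ι => μ) with hGdef
  have hsdc : (selfDualConst μ d : ℂ) ≠ 0 := by exact_mod_cast (selfDualConst_pos μ).ne'
  refine ⟨fun b => (selfDualConst μ d : ℂ)⁻¹ * fourierSB ψ μ G (-b),
    continuous_const.mul (continuous_fourierSB_integral_mul_psiSqPi_neg μ hd h2 hc hΦ hr),
    ⟨‖(selfDualConst μ d : ℂ)⁻¹‖ * ∫ β, ‖G β‖ ∂μ, fun b => ?_⟩, fun g hg => ?_⟩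
  · rw [norm_mul]
    exact mul_le_mul_of_nonneg_left (norm_fourierSB_integral_mul_psiSqPi_neg_le μ c Φ b) (norm_nonneg _)
  · simp_rw [mul_assoc]
    rw [integral_const_mul, integral_fourierSB_integral_mul_psiSqPi_neg_mul μ hd h2 hc hΦ hr hg,
      inv_mul_cancel_left₀ hsdc]

end FibreDensity

end Literature.NumberTheory.Weil1965
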